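import Literature.MathematicalPhysics.QuantumFieldTheory.Balaban1983to89.B12SmallFieldDomain259
import Literature.MathematicalPhysics.QuantumFieldTheory.Balaban1983to89.B12EuclTransf218
import Literature.MathematicalPhysics.QuantumFieldTheory.Balaban1983to89.T4Covariance

/-!
# `Balaban1983to89.B12ChiInvariance269` — [Balaban1987RG1] p. 269 «The characteristic function is invariant with
respect to the transformations of the fluctuation field B′, because they are local, orthogonal transformations» —
PROVED for the printed characteristic function `χ_k` of (2.9), for the gauge rotations (2.16) and for the
transformations generated by the Euclidean reflections (2.18)

HONEST FRAMING (cell `lit-balaban`, verbatim): statement-level skeleton of published theorems with citation tags;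
proofs where landed; nothing here is a claim about the Yang–Mills mass gap.

CITATION HEADER.  T. Bałaban, *Renormalization group approach to lattice gauge field theories. I. Generation of
effective actions in a small field approximation and a coupling constant renormalization in four dimensions*,
Commun. Math. Phys. **109** (1987) 249–301, doi:10.1007/bf01215223 [Balaban1987RG1] (cell paper B12; held text
`paper:balaban1987-cmp109-rg-i-small-field`, journal page = PDF page + 248; p. 266 [PDF 18] and p. 269 [PDF 21]
re-read this generation from the held text).  Unit `lit-balaban-r09` gen 6 (display owner of CMP 109), SKELETON
rows `B12.Eq2.16` / `B12.Txt@269` (the invariance bookkeeping of the new term (2.13)), `B12.Eq2.9` (`χ_k`),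
`B12.Eq2.17-2.18`.

WHAT IS PRINTED (verbatim).  p. 266 [PDF 18]: *«Finally we can define the characteristic function χ_k
χ_k = Π_{b∈T⁽ᵏ⁾∖{b₀(c): c∈T⁽ᵏ⁺¹⁾}} χ({|B′(b)| < ε₁}). (2.9)»* (v1.0 of this header quoted the product as «Π_{b∈T⁽ᵏ⁾}»,
without the excluded set — quotation finding D-K16-1, corrected in v1.1; see `B12SmallFieldDomain259` v1.2 § 5 for
`b₀(c)` and the printed function `chiFluctPrinted`).  p. 269 [PDF 21]: *«… all the expressions in (2.12), together with the
measure, are invariant with respect to the gauge transformations U_{k+1} → U^u_{k+1}, B′ → R(u)B′,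
(R(u)B′)(b) = R(u(b₋))B′(b). (2.16)  The characteristic function is invariant with respect to the transformations
of the fluctuation field B′, because they are local, orthogonal transformations; therefore the expression (2.13) is
gauge invariant.»* and, after (2.18): *«The transformation (2.18) generates an orthogonal transformation of the
fluctuation field B′, hence all the remaining operations preserve the invariance for the same reasons as for the
gauge invariance.»*

DICTIONARY print → Lean.  `χ_k` ↦ `B12SmallFieldDomain259.chiFluctPrinted ε₁ B` (r09 gen 10, v1.2: the `{0,1}`-valued
product (2.9) over the bonds of `T^{(k)}` MINUS the distinguished bonds `b₀(c)`, of a `𝔤`-valued bond field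
`B : VecField P k 𝔤`, `|·|` = a norm on `𝔤`; §§ 1–3 below treat the ALL-BONDS cutoff `B12SmallFieldDomain259.chiFluct`
of r09 gen 1 — `chiFluct = chiFluctPrinted · Π_c χ({|B′(b₀(c))| < ε₁})` — and § 4 (v1.1) the printed function);
«local, orthogonal transformations» ↦ a relabelling `σ` of the bonds composed with bondwise NORM-PRESERVING maps
`Φ_b : 𝔤 → 𝔤` (`chiFluct_comp_local_isometry` — exactly the two properties the printed reason names; linearity is
not needed for `χ_k`); (2.16) ↦ `rotFluct R u B = (b ↦ R(u(b₋)) B(b))` for a norm-preserving action `R` of the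
gauge group on `𝔤` (print: the adjoint action `R(u)X = uXu⁻¹` of `G ⊂ U(N)` on `𝔤 ⊂ M_N(ℂ)`, isometric for the
operator norm — the C⋆-identity `‖WXW^*‖ = ‖X‖`, tree: `T4AdjointCovarianceUnitary.opNorm_conj_unitary`); (2.18) ↦ r09 gen 2's `B12EuclTransf218.lin218 μ W` (p242556: the
transformation of `B′` generated by the reflection `r_μ` over a background with `μ`-bond variables `W(b) ∈ U(n)`:
`B′(rb)` off the `μ`-bonds, `−W(b)B′(−rb)W(b)^*` on them; its orthogonality for `Σ_b Re tr` is `lin218_orthogonal`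
there).

WHAT IS PROVED (kernel-checked, no `sorry`, standard axioms; one definition with body `rotFluct`, no `Prop` fact):
* `chiFluct_comp_local_isometry` — for every bond bijection `σ` and bondwise norm-preserving `Φ`,
  `χ_k(b ↦ Φ_b(B(σb))) = χ_k(B)` (the printed reason, for any normed value space);
* (2.16): `chiFluct_rotFluct` — `χ_k(R(u)B′) = χ_k(B′)` for every norm-preserving action `R` (hypothesis `hR`), and
  its discharge for the matrix model `chiFluct_rotFluct_unitary` (`𝔤`-valued fields read in `M_n(ℂ)` with the
  operator norm, `R(W)X = WXW^*`, `W` unitary: the C⋆-identity `‖WXW^*‖ = ‖X‖`, inlined);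
* (2.18): `chiFluct_lin218` — `χ_k(lin218 μ W B′) = χ_k(B′)` for the operator norm on `M_n(ℂ)` (bond relabelling =
  the reflection `PBond.reflectEquiv μ`; bondwise maps `X ↦ X` or `X ↦ −WXW^*`, both isometric).

WHAT IS NOT PROVED HERE (and not claimed): the invariance of «all the expressions in (2.12), together with the
measure» (the Gaussian fluctuation measure and the other factors of (2.12) are not objects of this file; the gauge
field measure `dU` and the renormalization transformations are treated in `B12RTGaugeInvariance254`, the gauge-fixing
term under coarse Euclidean maps in `B12GaugeFixInvariance269`); nothing about (2.13) beyond its factor `χ_k`.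
Pre-existing decls at the loci, imported or named, never re-declared: `B12SmallFieldDomain259.chiFluct`/`chiFluct_eq_prod`
((2.9)), `B12EuclTransf218.lin218`/`lin218_orthogonal`/`reInner_conj_conj` ((2.18)), `B12Inv329.*` ((3.29) invariance
bookkeeping), `B10Eq26MeasureInv` (B10 (26) mechanism), `T4AdjointCovarianceUnitary.opNorm_conj_unitary` / `B5Prop11Plancherel.opNorm_unitary_conj` (the C⋆ one-liner
`‖WXW^*‖ = ‖X‖`, not imported to keep the cone small; inlined as two rewrites).

v1.1 (unit `lit-balaban-r09` gen 10, 2026-08-21; APPEND-ONLY: new import `T4Covariance`, new §§ 4–6, header quotation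
of (2.9) and dictionary corrected, no v1.0 declaration changed): the p. 269 sentences for the PRINTED `χ_k` =
`B12SmallFieldDomain259.chiFluctPrinted` (v1.2) under the symmetries print names — «a Euclidean symmetry r of the torus T,
preserving the torus T⁽ᵏ⁺¹⁾» (p. 269), i.e. in the cell's centred block geometry (0.3) the COARSE translations `x ↦ x + L·a`
(`Site.scale`, `AveragingRT.line_translate`) and the CENTRE reflections `x_ρ ↦ −x_ρ − 1` (`GaugeField.creflect`,
`AveragingRT.crefBond`/`line_creflect_of_ne/eq` of `T4Covariance`; the naive axis reflection `x_ρ ↦ −x_ρ` of §3's `lin218`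
does NOT preserve `T⁽ᵏ⁺¹⁾ ⊂ T⁽ᵏ⁾`, `AveragingReflection.not_reflect_equivariant`):
 §4 `chiFluctPrinted_comp_local_isometry` (bond bijections PRESERVING the excluded set `{b₀(c)}` composed with bondwise
    isometries), (2.16) `chiFluctPrinted_rotFluct` / `_unitary` (gauge rotations move no bond);
 §5 the excluded set IS preserved by the block-compatible symmetries: `b0_translate` (`b₀(c + a) = b₀(c) + L·a`),
    `cbond` (the centred reflection on positively oriented bonds of ANY level, an involution `cbond_cbond`, `= crefBond`
    on coarse bonds), **`cbond_b0 : cbond ρ (b₀ c) = b₀ (cbond ρ c)`** (transverse lines go to lines sitewise, longitudinal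
    lines are traversed backwards and the middle bond `t = (L−1)/2 = L − 1 − t` stays the middle bond), whence
    `exists_b0_eq_translate_iff`, `exists_b0_eq_cbond_iff`;
 §6 the printed `χ_k` is invariant: `chiFluctPrinted_translate` ((2.17), translations), `chiFluctPrinted_cbond` (centre
    reflections with any bondwise isometries), and in the matrix model `clin218` = the transformation (2.18) generates for
    the centre reflection (`B′(c_ρ b)` off the `ρ`-bonds, `−W(b)B′(c_ρ b)W(b)^*` on them — §3's `lin218` with `cbond ρ`
    for `PBond.reflect ρ`) with `chiFluctPrinted_clin218`, plus the all-bonds twins `chiFluct_translate`/`chiFluct_clin218`.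
-/

namespace Literature.MathematicalPhysics.QuantumFieldTheory.Balaban1983to89.B12ChiInvariance269

open Literature.MathematicalPhysics.QuantumFieldTheory.Balaban1983to89

/-! ## 1. «local, orthogonal transformations» preserve `χ_k` -/

section Abstract

variable {P : Params} {k : ℕ} {𝔤 : Type*} [Norm 𝔤]

/-- **p. 269, the printed reason**: a transformation of the fluctuation field that relabels the bonds (`σ`) and acts
bondwise by norm-preserving maps (`Φ_b`) — «local, orthogonal» — leaves the characteristic function (2.9)
invariant: `χ_k(b ↦ Φ_b(B(σ b))) = χ_k(B)`. [cite: Balaban1987RG1, (2.16) p.269] -/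
theorem chiFluct_comp_local_isometry (ε₁ : ℝ) (σ : PBond P k ≃ PBond P k) (Φ : PBond P k → 𝔤 → 𝔤)
    (hΦ : ∀ b X, ‖Φ b X‖ = ‖X‖) (B : VecField P k 𝔤) :
    B12SmallFieldDomain259.chiFluct ε₁ (fun b => Φ b (B (σ b))) = B12SmallFieldDomain259.chiFluct ε₁ B := by
  have h : (∀ b : PBond P k, ‖Φ b (B (σ b))‖ < ε₁) ↔ ∀ b : PBond P k, ‖B b‖ < ε₁ := by
    constructor
    · intro H b
      have hb := H (σ.symm b)
      rwa [hΦ, Equiv.apply_symm_apply] at hb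
    · intro H b
      rw [hΦ]
      exact H (σ b)
  unfold B12SmallFieldDomain259.chiFluct
  by_cases H : ∀ b : PBond P k, ‖B b‖ < ε₁
  · rw [if_pos H, if_pos (h.mpr H)]
  · rw [if_neg H, if_neg (mt h.mp H)]

end Abstract

/-! ## 2. (2.16): the gauge rotations `B′ → R(u)B′` -/

section Gauge

variable {P : Params} {k : ℕ} {G : Type*} {𝔤 : Type*}

/-- **(2.16)** p. 269: the gauge transformation of the fluctuation field, `(R(u)B′)(b) = R(u(b₋))B′(b)`, for an
action `R` of the gauge group on the value space `𝔤` (print: the adjoint action). [cite: Balaban1987RG1, (2.16) p.269] -/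
def rotFluct (R : G → 𝔤 → 𝔤) (u : GaugeTransf P k G) (B : VecField P k 𝔤) : VecField P k 𝔤 :=
  fun b => R (u b.src) (B b)

variable [Norm 𝔤]

/-- **p. 269 «The characteristic function is invariant with respect to the transformations of the fluctuation field
B′, because they are local, orthogonal transformations»** — for (2.16): `χ_k(R(u)B′) = χ_k(B′)` whenever every
`R(g)` preserves the norm `|·|` of `𝔤`. [cite: Balaban1987RG1, (2.16) p.269] -/
theorem chiFluct_rotFluct (R : G → 𝔤 → 𝔤) (hR : ∀ g X, ‖R g X‖ = ‖X‖) (ε₁ : ℝ) (u : GaugeTransf P k G)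
    (B : VecField P k 𝔤) : B12SmallFieldDomain259.chiFluct ε₁ (rotFluct R u B) = B12SmallFieldDomain259.chiFluct ε₁ B :=
  chiFluct_comp_local_isometry ε₁ (Equiv.refl _) (fun b => R (u b.src)) (fun b X => hR (u b.src) X) B

end Gauge

/-! ## 3. The matrix model: `𝔤 ⊂ M_n(ℂ)` with the operator norm, `R(W)X = WXW^*` -/

section MatrixModel

open scoped Matrix.Norms.L2Operator

variable {n : Type*} [Fintype n] [DecidableEq n]

/- Unitary conjugation is an isometry of the operator norm on `M_n(ℂ)`, `‖WXW^*‖ = ‖X‖` — a C⋆-identity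
(`CStarRing.norm_mul_mem_unitary`/`norm_mem_unitary_mul`); in the tree as
`T4AdjointCovarianceUnitary.opNorm_conj_unitary` and `B5Prop11Plancherel.opNorm_unitary_conj` (not imported here to
keep this file's cone at `B12SmallFieldDomain259` + `B12EuclTransf218`; the two rewrites are inlined below). -/

variable {P : Params} {k : ℕ}

/-- (2.16) in the matrix model: `χ_k` is invariant under `B′(b) ↦ u(b₋)B′(b)u(b₋)^*`, `u` unitary-valued, for the
operator norm `|·|`. [cite: Balaban1987RG1, (2.16) p.269] -/
theorem chiFluct_rotFluct_unitary (ε₁ : ℝ) (u : GaugeTransf P k (Matrix.unitaryGroup n ℂ))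
    (B : VecField P k (Matrix n n ℂ)) :
    B12SmallFieldDomain259.chiFluct ε₁ (rotFluct (fun (W : Matrix.unitaryGroup n ℂ) (X : Matrix n n ℂ) =>
      (W : Matrix n n ℂ) * X * star (W : Matrix n n ℂ)) u B) = B12SmallFieldDomain259.chiFluct ε₁ B :=
  chiFluct_rotFluct _ (fun W X => by
    rw [CStarRing.norm_mul_mem_unitary _ (Unitary.star_mem W.2), CStarRing.norm_mem_unitary_mul _ W.2]) ε₁ u B

/-- **p. 269 «The transformation (2.18) generates an orthogonal transformation of the fluctuation field B′, hence all
the remaining operations preserve the invariance»** — for the characteristic function: `χ_k(lin218 μ W B′) = χ_k(B′)`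
(`B12EuclTransf218.lin218`: `B′(r_μ b)` off the `μ`-bonds, `−W(b)B′(−r_μ b)W(b)^*` on them; bond relabelling = the
reflection `PBond.reflectEquiv μ`, bondwise maps isometric for the operator norm). [cite: Balaban1987RG1, (2.18) p.269] -/
theorem chiFluct_lin218 (ε₁ : ℝ) (μ : Fin P.d) (W : PBond P k → Matrix.unitaryGroup n ℂ)
    (B : VecField P k (Matrix n n ℂ)) :
    B12SmallFieldDomain259.chiFluct ε₁ (B12EuclTransf218.lin218 μ W B) = B12SmallFieldDomain259.chiFluct ε₁ B := by
  have h := chiFluct_comp_local_isometry ε₁ (PBond.reflectEquiv μ)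
    (fun b X => if b.dir = μ then -((W b : Matrix n n ℂ) * X * star (W b : Matrix n n ℂ)) else X)
    (fun b X => by
      split_ifs
      · rw [norm_neg, CStarRing.norm_mul_mem_unitary _ (Unitary.star_mem (W b).2),
          CStarRing.norm_mem_unitary_mul _ (W b).2]
      · rfl) B
  exact h

end MatrixModel

/-! ## 4. (v1.1) The PRINTED `χ_k` of (2.9): the product over `T⁽ᵏ⁾ ∖ {b₀(c) : c ∈ T⁽ᵏ⁺¹⁾}` -/

section Printed

variable {P : Params} {k : ℕ} {𝔤 : Type*} [Norm 𝔤]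

/-- **p. 269, the printed reason, for the printed `χ_k` (2.9)**: a transformation of the fluctuation field that
relabels the bonds by a bijection `σ` PRESERVING the set of distinguished bonds `{b₀(c) : c ∈ T⁽ᵏ⁺¹⁾}` (hypothesis
`hσ`; discharged in § 5 for the symmetries «preserving the torus T⁽ᵏ⁺¹⁾» of p. 269) and acts bondwise by norm-preserving
maps `Φ_b` leaves `χ_k = Π_{b∉{b₀(c)}} χ({|B′(b)| < ε₁})` invariant. [cite: Balaban1987RG1, (2.16) p.269] -/
theorem chiFluctPrinted_comp_local_isometry (ε₁ : ℝ) (σ : PBond P k ≃ PBond P k)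
    (hσ : ∀ b : PBond P k, (∃ c : PBond P (k+1), B12SmallFieldDomain259.b0 c = σ b) ↔
      ∃ c : PBond P (k+1), B12SmallFieldDomain259.b0 c = b)
    (Φ : PBond P k → 𝔤 → 𝔤) (hΦ : ∀ b X, ‖Φ b X‖ = ‖X‖) (B : VecField P k 𝔤) :
    B12SmallFieldDomain259.chiFluctPrinted ε₁ (fun b => Φ b (B (σ b))) =
      B12SmallFieldDomain259.chiFluctPrinted ε₁ B := by
  have h : (∀ b : PBond P k, (¬ ∃ c : PBond P (k+1), B12SmallFieldDomain259.b0 c = b) → ‖Φ b (B (σ b))‖ < ε₁) ↔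
      ∀ b : PBond P k, (¬ ∃ c : PBond P (k+1), B12SmallFieldDomain259.b0 c = b) → ‖B b‖ < ε₁ := by
    constructor
    · intro H b hb
      have hb' : ¬ ∃ c : PBond P (k+1), B12SmallFieldDomain259.b0 c = σ.symm b := by
        rw [← hσ (σ.symm b), Equiv.apply_symm_apply]
        exact hb
      have h1 := H (σ.symm b) hb'
      rwa [hΦ, Equiv.apply_symm_apply] at h1
    · intro H b hb
      rw [hΦ]
      exact H (σ b) ((hσ b).not.mpr hb)
  unfold B12SmallFieldDomain259.chiFluctPrinted
  by_cases H : ∀ b : PBond P k, (¬ ∃ c : PBond P (k+1), B12SmallFieldDomain259.b0 c = b) → ‖B b‖ < ε₁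
  · rw [if_pos H, if_pos (h.mpr H)]
  · rw [if_neg H, if_neg (mt h.mp H)]

variable {G : Type*}

/-- **(2.16) for the printed `χ_k`**: `χ_k(R(u)B′) = χ_k(B′)` whenever every `R(g)` preserves the norm of `𝔤` — the
gauge rotations act bondwise and move no bond, so the excluded set is trivially preserved.
[cite: Balaban1987RG1, (2.16) p.269] -/
theorem chiFluctPrinted_rotFluct (R : G → 𝔤 → 𝔤) (hR : ∀ g X, ‖R g X‖ = ‖X‖) (ε₁ : ℝ) (u : GaugeTransf P k G)
    (B : VecField P k 𝔤) :
    B12SmallFieldDomain259.chiFluctPrinted ε₁ (rotFluct R u B) = B12SmallFieldDomain259.chiFluctPrinted ε₁ B :=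
  chiFluctPrinted_comp_local_isometry ε₁ (Equiv.refl _) (fun _ => Iff.rfl) (fun b => R (u b.src))
    (fun b X => hR (u b.src) X) B

end Printed

section PrintedMatrix

open scoped Matrix.Norms.L2Operator

variable {n : Type*} [Fintype n] [DecidableEq n] {P : Params} {k : ℕ}

/-- (2.16) for the printed `χ_k` in the matrix model: invariance under `B′(b) ↦ u(b₋)B′(b)u(b₋)^*`, `u`
unitary-valued, operator norm. [cite: Balaban1987RG1, (2.16) p.269] -/
theorem chiFluctPrinted_rotFluct_unitary (ε₁ : ℝ) (u : GaugeTransf P k (Matrix.unitaryGroup n ℂ))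
    (B : VecField P k (Matrix n n ℂ)) :
    B12SmallFieldDomain259.chiFluctPrinted ε₁ (rotFluct (fun (W : Matrix.unitaryGroup n ℂ) (X : Matrix n n ℂ) =>
      (W : Matrix n n ℂ) * X * star (W : Matrix n n ℂ)) u B) = B12SmallFieldDomain259.chiFluctPrinted ε₁ B :=
  chiFluctPrinted_rotFluct _ (fun W X => by
    rw [CStarRing.norm_mul_mem_unitary _ (Unitary.star_mem W.2), CStarRing.norm_mem_unitary_mul _ W.2]) ε₁ u B

/-- The all-bonds statement of § 3 and the printed one agree where the eliminated variables are `< ε₁`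
(bookkeeping corollary). [cite: Balaban1987RG1, (2.16) p.269] -/
theorem chiFluct_rotFluct_unitary_eq_printed (ε₁ : ℝ) (u : GaugeTransf P k (Matrix.unitaryGroup n ℂ))
    (B : VecField P k (Matrix n n ℂ))
    (h : ∀ c : PBond P (k+1), ‖B (B12SmallFieldDomain259.b0 c)‖ < ε₁) :
    B12SmallFieldDomain259.chiFluct ε₁ (rotFluct (fun (W : Matrix.unitaryGroup n ℂ) (X : Matrix n n ℂ) =>
      (W : Matrix n n ℂ) * X * star (W : Matrix n n ℂ)) u B) = B12SmallFieldDomain259.chiFluctPrinted ε₁ B := by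
  rw [chiFluct_rotFluct_unitary, ← B12SmallFieldDomain259.chiFluctPrinted_eq_chiFluct_of ε₁ B h]

end PrintedMatrix

/-! ## 5. (v1.1) The excluded set `{b₀(c)}` under the symmetries «preserving the torus T⁽ᵏ⁺¹⁾» (p. 269):
coarse translations `x ↦ x + L·a` and centre reflections `x_ρ ↦ −x_ρ − 1` of the centred block geometry (0.3) -/

section BlockSymmetries

variable {P : Params} {j k : ℕ}

/-- **(2.17) for translations, on the distinguished bonds**: `b₀(c + a) = b₀(c) + L·a` — a coarse translation by
`a ∈ T⁽ᵏ⁺¹⁾` is the fine translation by `L·a` (`Site.scale a`, `Site.emb_add`) and carries the straight contour of `c`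
onto that of `c + a` (`AveragingRT.line_translate`). [cite: Balaban1987RG1, (2.17) p.269] -/
theorem b0_translate (c : PBond P (k+1)) (a : Site P (k+1)) :
    B12SmallFieldDomain259.b0 (c.translate a) = (B12SmallFieldDomain259.b0 c).translate (Site.scale a) :=
  AveragingRT.line_translate c a _

/-- Translation by `0` fixes every bond. [cite: Balaban1987RG1, (2.17) p.269] -/
theorem translate_zero_bond (b : PBond P j) : b.translate (0 : Site P j) = b := by
  cases b; simp [PBond.translate]

/-- The fine translations by coarse vectors PRESERVE the excluded set `{b₀(c) : c ∈ T⁽ᵏ⁺¹⁾}`.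
[cite: Balaban1987RG1, (2.17) p.269] -/
theorem exists_b0_eq_translate_iff (a : Site P (k+1)) (b : PBond P k) :
    (∃ c : PBond P (k+1), B12SmallFieldDomain259.b0 c = b.translate (Site.scale a)) ↔
      ∃ c : PBond P (k+1), B12SmallFieldDomain259.b0 c = b := by
  constructor
  · rintro ⟨c, hc⟩
    refine ⟨c.translate (-a), ?_⟩
    rw [b0_translate, hc, PBond.translate_translate, map_neg, add_neg_cancel, translate_zero_bond]
  · rintro ⟨c, rfl⟩
    exact ⟨c.translate a, b0_translate c a⟩

/-- **THE CENTRE REFLECTION ON BONDS** (any level `j`): the positively oriented bond underlying `r_ρ b` for the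
reflection `x_ρ ↦ −x_ρ − 1` of the centred labels — the tree's axis reflection `PBond.reflect ρ` followed by the
translation by `−e_ρ` (on configurations this is `GaugeField.creflect`, on coarse bonds `AveragingRT.crefBond`);
`ρ`-bonds are traversed backwards by `r_ρ`, as in (2.18). [cite: Balaban1987RG1, (2.17) p.269] -/
def cbond (ρ : Fin P.d) (b : PBond P j) : PBond P j := (b.reflect ρ).translate ((0 : Site P j).unshift ρ)

/-- On coarse bonds `cbond` is `T4Covariance`'s `AveragingRT.crefBond`. [cite: Balaban1987RG1, (2.17) p.269] -/
theorem cbond_eq_crefBond (ρ : Fin P.d) (c : PBond P (k+1)) : cbond ρ c = AveragingRT.crefBond ρ c := rfl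

/-- `cbond` preserves directions. [cite: Balaban1987RG1, (2.17) p.269] -/
@[simp] theorem cbond_dir (ρ : Fin P.d) (b : PBond P j) : (cbond ρ b).dir = b.dir := rfl

/-- Source of `cbond ρ b`, transverse case: `(r_ρ b₋) − e_ρ`. [cite: Balaban1987RG1, (2.17) p.269] -/
theorem cbond_src_of_ne (ρ : Fin P.d) (b : PBond P j) (h : b.dir ≠ ρ) :
    (cbond ρ b).src = (b.src.reflect ρ).unshift ρ := by
  show (b.reflect ρ).src + (0 : Site P j).unshift ρ = _
  rw [PBond.reflect_src_of_ne ρ b h, Site.add_zero_unshift]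

/-- Source of `cbond ρ b`, longitudinal case: `r_ρ(b₋ + e_ρ) − e_ρ = r_ρ b₋ − 2e_ρ`. [cite: Balaban1987RG1, (2.17) p.269] -/
theorem cbond_src_of_eq (ρ : Fin P.d) (b : PBond P j) (h : b.dir = ρ) :
    (cbond ρ b).src = ((b.src.reflect ρ).unshift ρ).unshift ρ := by
  show (b.reflect ρ).src + (0 : Site P j).unshift ρ = _
  rw [PBond.reflect_src_of_eq ρ b h, Site.add_zero_unshift, Site.shift_reflect_self]

/-- The centre reflection on bonds is an involution. [cite: Balaban1987RG1, (2.17) p.269] -/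
theorem cbond_cbond (ρ : Fin P.d) (b : PBond P j) : cbond ρ (cbond ρ b) = b := by
  rcases eq_or_ne b.dir ρ with h | h
  · have h' : (cbond ρ b).dir = ρ := h
    apply B12SmallFieldDomain259.bond_eq_of_src_eq_of_tgt_eq
    · rw [cbond_src_of_eq ρ _ h', cbond_src_of_eq ρ b h, Site.unshift_reflect_self, Site.unshift_reflect_self,
        Site.reflect_reflect, Site.unshift_shift, Site.unshift_shift]
    · simp only [PBond.tgt, cbond_dir]
      rw [cbond_src_of_eq ρ _ h', cbond_src_of_eq ρ b h, Site.unshift_reflect_self, Site.unshift_reflect_self,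
        Site.reflect_reflect, Site.unshift_shift, Site.unshift_shift]
  · have h' : (cbond ρ b).dir ≠ ρ := h
    apply B12SmallFieldDomain259.bond_eq_of_src_eq_of_tgt_eq
    · rw [cbond_src_of_ne ρ _ h', cbond_src_of_ne ρ b h, Site.unshift_reflect_self, Site.reflect_reflect,
        Site.unshift_shift]
    · simp only [PBond.tgt, cbond_dir]
      rw [cbond_src_of_ne ρ _ h', cbond_src_of_ne ρ b h, Site.unshift_reflect_self, Site.reflect_reflect,
        Site.unshift_shift]

/-- The centre reflection on bonds as a bijection. [cite: Balaban1987RG1, (2.17) p.269] -/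
def cbondEquiv (ρ : Fin P.d) : PBond P j ≃ PBond P j :=
  Function.Involutive.toPerm (cbond ρ) (cbond_cbond ρ)

/-- `cbondEquiv` is `cbond`. [cite: Balaban1987RG1, (2.17) p.269] -/
@[simp] theorem cbondEquiv_apply (ρ : Fin P.d) (b : PBond P j) : cbondEquiv ρ b = cbond ρ b := rfl

/-- **The centre reflection carries `b₀(c)` to `b₀(r c)`**: transversally (`c ⊥ e_ρ`) the straight contour of `c`
goes to that of `cbond ρ c` site by site (`AveragingRT.line_creflect_of_ne`); longitudinally (`c ∥ e_ρ`) it is traversed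
backwards, the `t`-th bond going to the `(L−1−t)`-th (`line_creflect_of_eq`), and the middle bond `t = (L−1)/2` (`L`
odd) is fixed as the middle bond. [cite: Balaban1987RG1, (2.17) p.269] -/
theorem cbond_b0 (ρ : Fin P.d) (c : PBond P (k+1)) :
    cbond ρ (B12SmallFieldDomain259.b0 c) = B12SmallFieldDomain259.b0 (cbond ρ c) := by
  rcases eq_or_ne c.dir ρ with h | h
  · have hL := P.hL.2
    obtain ⟨i, hi⟩ := P.hL.1
    have ht : (P.L - 1) / 2 < P.L := by omega
    have hmid : P.L - 1 - (P.L - 1) / 2 = (P.L - 1) / 2 := by omega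
    show ((AveragingRT.line c ((P.L - 1) / 2)).reflect ρ).translate ((0 : Site P k).unshift ρ) = _
    rw [AveragingRT.line_creflect_of_eq ρ c h ht, hmid]
    rfl
  · show ((AveragingRT.line c ((P.L - 1) / 2)).reflect ρ).translate ((0 : Site P k).unshift ρ) = _
    rw [AveragingRT.line_creflect_of_ne ρ c h]
    rfl

/-- The centre reflections PRESERVE the excluded set `{b₀(c) : c ∈ T⁽ᵏ⁺¹⁾}`. [cite: Balaban1987RG1, (2.17) p.269] -/
theorem exists_b0_eq_cbond_iff (ρ : Fin P.d) (b : PBond P k) :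
    (∃ c : PBond P (k+1), B12SmallFieldDomain259.b0 c = cbond ρ b) ↔
      ∃ c : PBond P (k+1), B12SmallFieldDomain259.b0 c = b := by
  constructor
  · rintro ⟨c, hc⟩
    refine ⟨cbond ρ c, ?_⟩
    rw [← cbond_b0, hc, cbond_cbond]
  · rintro ⟨c, rfl⟩
    exact ⟨cbond ρ c, (cbond_b0 ρ c).symm⟩

end BlockSymmetries

/-! ## 6. (v1.1) «The transformation (2.18) generates an orthogonal transformation of the fluctuation field B′, hence
all the remaining operations preserve the invariance» — for the PRINTED `χ_k`, with the block-compatible symmetries -/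

section PrintedEuclid

variable {P : Params} {k : ℕ} {𝔤 : Type*} [Norm 𝔤]

/-- **(2.17), translations, for the printed `χ_k`**: relabelling the bonds by the fine translation `b ↦ b + L·a`,
`a ∈ T⁽ᵏ⁺¹⁾`, composed with any bondwise isometries, leaves `χ_k` invariant. [cite: Balaban1987RG1, (2.17) p.269] -/
theorem chiFluctPrinted_translate (ε₁ : ℝ) (a : Site P (k+1)) (Φ : PBond P k → 𝔤 → 𝔤)
    (hΦ : ∀ b X, ‖Φ b X‖ = ‖X‖) (B : VecField P k 𝔤) :
    B12SmallFieldDomain259.chiFluctPrinted ε₁ (fun b => Φ b (B (b.translate (Site.scale a)))) =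
      B12SmallFieldDomain259.chiFluctPrinted ε₁ B :=
  chiFluctPrinted_comp_local_isometry ε₁ (PBond.translateEquiv (Site.scale a))
    (fun b => exists_b0_eq_translate_iff a b) Φ hΦ B

/-- **(2.17)/(2.18), centre reflections, for the printed `χ_k`**: relabelling the bonds by the centre reflection
`cbond ρ` composed with any bondwise isometries leaves `χ_k` invariant. [cite: Balaban1987RG1, (2.18) p.269] -/
theorem chiFluctPrinted_cbond (ε₁ : ℝ) (ρ : Fin P.d) (Φ : PBond P k → 𝔤 → 𝔤) (hΦ : ∀ b X, ‖Φ b X‖ = ‖X‖)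
    (B : VecField P k 𝔤) :
    B12SmallFieldDomain259.chiFluctPrinted ε₁ (fun b => Φ b (B (cbond ρ b))) =
      B12SmallFieldDomain259.chiFluctPrinted ε₁ B :=
  chiFluctPrinted_comp_local_isometry ε₁ (cbondEquiv ρ) (fun b => exists_b0_eq_cbond_iff ρ b) Φ hΦ B

/-- The all-bonds cutoff of `B12SmallFieldDomain259` § 2 under the same translations (no preservation needed).
[cite: Balaban1987RG1, (2.17) p.269] -/
theorem chiFluct_translate (ε₁ : ℝ) (a : Site P (k+1)) (Φ : PBond P k → 𝔤 → 𝔤) (hΦ : ∀ b X, ‖Φ b X‖ = ‖X‖)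
    (B : VecField P k 𝔤) :
    B12SmallFieldDomain259.chiFluct ε₁ (fun b => Φ b (B (b.translate (Site.scale a)))) =
      B12SmallFieldDomain259.chiFluct ε₁ B :=
  chiFluct_comp_local_isometry ε₁ (PBond.translateEquiv (Site.scale a)) Φ hΦ B

end PrintedEuclid

section PrintedEuclidMatrix

open scoped Matrix.Norms.L2Operator

variable {n : Type*} [Fintype n] [DecidableEq n] {P : Params} {j k : ℕ}

/-- The transformation of the `𝔤`-valued fluctuation field generated by (2.18) for the CENTRE reflection `r = c_ρ`
over a background with `ρ`-bond variables `W(b) ∈ U(n)`: `B′(c_ρ b)` on bonds of direction `≠ ρ` and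
`−W(b)B′(c_ρ b)W(b)^*` on `ρ`-bonds — § 3's `B12EuclTransf218.lin218` with the block-compatible `cbond ρ` in place of the
naive `PBond.reflect ρ`. [cite: Balaban1987RG1, (2.18) p.269] -/
def clin218 (ρ : Fin P.d) (W : PBond P j → Matrix.unitaryGroup n ℂ) (B : PBond P j → Matrix n n ℂ) :
    PBond P j → Matrix n n ℂ := fun b =>
  if b.dir = ρ then -((W b : Matrix n n ℂ) * B (cbond ρ b) * star (W b : Matrix n n ℂ)) else B (cbond ρ b)

/-- **(2.18) for the printed `χ_k`, centre reflection, matrix model**: `χ_k(clin218 ρ W B′) = χ_k(B′)` for the operator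
norm on `M_n(ℂ)` (bond relabelling `cbond ρ` preserves `{b₀(c)}`; bondwise maps `X ↦ X` or `X ↦ −WXW^*`, isometric).
[cite: Balaban1987RG1, (2.18) p.269] -/
theorem chiFluctPrinted_clin218 (ε₁ : ℝ) (ρ : Fin P.d) (W : PBond P k → Matrix.unitaryGroup n ℂ)
    (B : VecField P k (Matrix n n ℂ)) :
    B12SmallFieldDomain259.chiFluctPrinted ε₁ (clin218 ρ W B) = B12SmallFieldDomain259.chiFluctPrinted ε₁ B :=
  chiFluctPrinted_cbond ε₁ ρ
    (fun b X => if b.dir = ρ then -((W b : Matrix n n ℂ) * X * star (W b : Matrix n n ℂ)) else X)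
    (fun b X => by
      split_ifs
      · rw [norm_neg, CStarRing.norm_mul_mem_unitary _ (Unitary.star_mem (W b).2),
          CStarRing.norm_mem_unitary_mul _ (W b).2]
      · rfl) B

/-- The all-bonds cutoff under the same transformation (any bond bijection qualifies). [cite: Balaban1987RG1, (2.18) p.269] -/
theorem chiFluct_clin218 (ε₁ : ℝ) (ρ : Fin P.d) (W : PBond P k → Matrix.unitaryGroup n ℂ)
    (B : VecField P k (Matrix n n ℂ)) :
    B12SmallFieldDomain259.chiFluct ε₁ (clin218 ρ W B) = B12SmallFieldDomain259.chiFluct ε₁ B :=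
  chiFluct_comp_local_isometry ε₁ (cbondEquiv ρ)
    (fun b X => if b.dir = ρ then -((W b : Matrix n n ℂ) * X * star (W b : Matrix n n ℂ)) else X)
    (fun b X => by
      split_ifs
      · rw [norm_neg, CStarRing.norm_mul_mem_unitary _ (Unitary.star_mem (W b).2),
          CStarRing.norm_mem_unitary_mul _ (W b).2]
      · rfl) B

end PrintedEuclidMatrix

end Literature.MathematicalPhysics.QuantumFieldTheory.Balaban1983to89.B12ChiInvariance269
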